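import Literature.NumberTheory.EllipticCurves.BSDSelmerParityDokchitserHeegnerFieldProofs
import Literature.NumberTheory.EllipticCurves.SelmerParityCyclicExtension
import Literature.NumberTheory.EllipticCurves.SelmerRestrictionCorankRelative
import Literature.NumberTheory.EllipticCurves.ZpCorankCyclotomicDivisibility
import Literature.NumberTheory.EllipticCurves.ZpExtensionAnticyclotomicHoldsProofs
import Literature.NumberTheory.EllipticCurves.IwasawaSelmerControlKernelProofs
import HarnessLib

/-!
# bsd.S19, step (4) over the Heegner field: the printed proof with Cor. 4.15 PROVED
(second decomposition of `Literature.NumberTheory.EllipticCurves.dokchitser_selmerCorank_baseChange_mod_two_eq`)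

Sequel to `BSDSelmerParityDokchitserHeegnerFieldProofs`, which reduced the named fact
`dokchitser_selmerCorank_baseChange_mod_two_eq` (T. Dokchitser, V. Dokchitser, Ann. of Math. 172
(2010), §4.6, proof of Thm. 4.19 (= Thm. 1.4), for `E/M₀`: `rk_p(E/M₀)` is odd for `E/ℚ`, `p` odd,
`M₀` imaginary quadratic with all bad primes split) to its printed inputs `h415` (Cor. 4.15),
`h417` (the dihedral congruence of p. 27) and `hCV` (Cornut–Vatsal / Tian–Zhang / Nekovář), over
the anticyclotomic `ℤ_p`-extension `κ` of `M₀` (`hanti`). Here **Cor. 4.15 is no longer a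
hypothesis**: it is the tree theorem
`WeierstrassCurve.selmerCorank_mod_two_eq_zpCorank_selmerGroupOver_of_cyclic`
(`SelmerParityCyclicExtension`: Lemma 4.14 by restriction–corestriction, the finiteness of the
`p`-Selmer group at every finite level, and the `ℚ_p[C_{p^n}]`-parity count), which gives, for
every layer `M_n` of any `ℤ_p`-extension of `M₀` (`Γ_{M₀} / Gal(M̄₀/M_n) ≅ ℤ/p^n` cyclic),
`rk_p(E/M₀) ≡ rk_p(E/M_n) (mod 2)` (`selmerCorank_baseChange_mod_two_eq_layer`) — "the same holds
for the `p^∞`-Selmer rank (Corollary 4.15)" of p. 26.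

Accordingly the Selmer rank of `E` over the layer `M_n` is transcribed in the tree's model of
Selmer groups over the layers of a `ℤ_p`-extension (`WeierstrassCurve.selmerGroupOver W p
(κ.layerSubgroup n)`, files `SubgroupSelmer` / `IwasawaSelmer`: `Sel_{p^∞}(E/M_n)` inside
`H¹(Gal(M̄₀/M_n), E[p^∞])`, the convention of Greenberg's `Sel_E(F_n)_p` used throughout the
tree's Iwasawa theory):
`rk_p(E/M_n) = X n := zpCorank (Sel_{p^∞}(E/M_n)) p`. The two remaining printed inputs are the
same displayed statements as before, in this transcription:

* `h417` — p. 27: `rk_p(E/M_n) + m_ρ` is even, where `(p - 1) m_ρ = rk_p(E/M_{n+1}) - rk_p(E/M_n)`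
  (Lemma 4.14 for `Gal(M_{n+1}/M_n) ≅ C_p` and Prop. 4.17 for `D_{2p}`, all bad primes split);
* `hCV` — p. 27: `rk_p(E/M_{n+1}) = rk_p(E/M_n) + (p - 1) p^n` for all large `n`
  (Cornut–Vatsal 2007, Thm. 1.5 / 4.2, with Yuan–Zhang–Zhang and Tian–Zhang / Nekovář Thm. 3.2).

Proved here, for ANY elliptic curve over ANY number field `K` and any `ℤ_p`-extension of `K` (`p` odd):
`WeierstrassCurve.selmerCorank_mod_two_eq_zpCorank_selmerGroupOver_layer` (Cor. 4.15 along the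
layers), `WeierstrassCurve.exists_zpCorank_selmerGroupOver_layer_succ_eq` (the multiplicity `m_ρ`)
and the skeleton `WeierstrassCurve.odd_selmerCorank_of_layer_congruence_of_growth` (dihedral
congruence + eventual growth `φ(p^{n+1})` per layer ⟹ `rk_p(E/K)` odd); and, in the setting of
§4.6 (`E = W_{M₀}`, `W/ℚ`), `odd_selmerCorank_baseChange_of_anticyclotomic_of_printed'` and
`dokchitser_selmerCorank_baseChange_mod_two_eq_of_printed'` — the target fact from `hanti`,
`h417`, `hCV` alone — and `dokchitser_selmerCorank_baseChange_mod_two_eq_of_printed''`, from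
`h417` and `hCV` ONLY: the anticyclotomic `ℤ_p`-extension of `M₀` exists by the tree theorem
`ZpExtension.exists_isAnticyclotomic_holds` (`ZpExtensionAnticyclotomicHoldsProofs`). Nothing is
weakened and no named fact is introduced (D-0026); the two remaining leaves (the
regulator-constant / isogeny-invariance theory of §§4.1–4.5 behind Prop. 4.17, and CM points in
the anticyclotomic tower) are unformalised theories.

## References

* [DokchitserDokchitserAnnals2010] T. Dokchitser, V. Dokchitser, Ann. of Math. 172 (2010) =
  arXiv:math/0610290: Lemma 4.14, Cor. 4.15, Prop. 4.17, §4.6 proof of Thm. 4.19 (pp. 24–27;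
  arXiv numbering Lemma 47, Cor. 48, Prop. 50, Thm. 52).
* [CornutVatsal2007] C. Cornut, V. Vatsal, in *L-functions and Galois representations* (2007),
  Thm. 1.5, Thm. 4.2.
* [Nekovar2007] J. Nekovář, Math. Ann. 337 (2007), Thm. 3.2.
* [GreenbergLNM1716] R. Greenberg, LNM 1716 (1999), §2 (`Sel_E(F_n)_p`).
-/

noncomputable section

open scoped Classical AddSubgroup

open WeierstrassCurve Literature.NumberTheory.QuadraticFields

namespace Literature.NumberTheory.EllipticCurves

/-! ### Layers of a `ℤ_p`-extension: cyclic quotients -/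

namespace ZpExtension

variable {K : Type} [Field K] {p : ℕ} [Fact p.Prime] (κ : ZpExtension K p)

/-- **`Γ_K = ⋃_k Gal(K̄/K_n) γ^k`** for a topological generator `γ` (`κ γ = 1`): for `g ∈ Γ_K`,
with `k = (κ g mod p^n) ∈ ℕ` (`PadicInt.appr`), `g γ^{-k}` lies in `κ⁻¹(p^n ℤ_p) = Gal(K̄/K_n)`.
So `Gal(K_n/K) ≅ ℤ/p^n` is cyclic, generated by `γ`. Washington, *Introduction to Cyclotomic
Fields*, §13.1. [folklore] -/
theorem exists_layerSubgroup_mul_pow {γ : Field.absoluteGaloisGroup K} (hγ : κ.IsTopGenerator γ)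
    (n : ℕ) (g : Field.absoluteGaloisGroup K) :
    ∃ (h : κ.layerSubgroup n) (k : ℕ), g = h * γ ^ k := by
  set x : ℤ_[p] := (κ g).toAdd with hx
  have happr := PadicInt.appr_spec n x
  refine ⟨⟨g * (γ ^ x.appr n)⁻¹, ?_⟩, x.appr n, by rw [Subgroup.coe_mk, inv_mul_cancel_right]⟩
  rw [mem_layerSubgroup, map_mul, map_inv, toAdd_mul, toAdd_inv, map_pow,
    show κ γ = Multiplicative.ofAdd 1 from hγ, ← ofAdd_nsmul, toAdd_ofAdd, nsmul_eq_mul, mul_one,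
    ← sub_eq_add_neg]
  exact Ideal.mem_span_singleton.mp happr

/-- **`Gal(K̄/K_n) = ⋃_j Gal(K̄/K_{n+1}) (γ^{p^n})^j`**: an element of the `n`-th layer subgroup is
`h (γ^{p^n})^j` with `h` in the `(n+1)`-st (`κ g ≡ 0 mod p^n` forces `p^n ∣ k` in `g = h γ^k`).
So `Gal(K_{n+1}/K_n) ≅ ℤ/p` is generated by `γ^{p^n}`. Washington, §13.1. [folklore] -/
theorem exists_layerSubgroup_succ_mul_pow {γ : Field.absoluteGaloisGroup K} (hγ : κ.IsTopGenerator γ)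
    (n : ℕ) (g : κ.layerSubgroup n) :
    ∃ (h : κ.layerSubgroup (n + 1)) (j : ℕ), (g : Field.absoluteGaloisGroup K) = h * (γ ^ p ^ n) ^ j := by
  obtain ⟨h, k, hk⟩ := κ.exists_layerSubgroup_mul_pow hγ (n + 1) g
  -- `γ^k = h⁻¹ g ∈ Gal(K̄/K_n)`, so `p^n ∣ k`
  have hγk : γ ^ k ∈ κ.layerSubgroup n := by
    have e : γ ^ k = (h : Field.absoluteGaloisGroup K)⁻¹ * g := by rw [hk, inv_mul_cancel_left]
    rw [e]
    exact (κ.layerSubgroup n).mul_mem ((κ.layerSubgroup n).inv_mem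
      (κ.layerSubgroup_antitone n.le_succ h.2)) g.2
  rw [mem_layerSubgroup, map_pow, show κ γ = Multiplicative.ofAdd 1 from hγ, ← ofAdd_nsmul,
    toAdd_ofAdd, nsmul_eq_mul, mul_one] at hγk
  have hdvd : p ^ n ∣ k := by
    have h1 : ((p : ℤ_[p]) ^ n ∣ ((k : ℤ) : ℤ_[p])) := by rwa [Int.cast_natCast]
    rw [PadicInt.pow_p_dvd_int_iff] at h1
    exact_mod_cast h1
  obtain ⟨j, rfl⟩ := hdvd
  exact ⟨h, j, by rw [hk, pow_mul]⟩

/-- A topological generator exists (`κ` is onto `ℤ_p ∋ 1`). [folklore] -/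
theorem exists_isTopGenerator : ∃ γ : Field.absoluteGaloisGroup K, κ.IsTopGenerator γ :=
  κ.surjective (Multiplicative.ofAdd 1)

/-- `Gal(K̄/K_n)` has finite index `p^n` in `Γ_K`. [folklore] -/
theorem finiteIndex_layerSubgroup (n : ℕ) : (κ.layerSubgroup n).FiniteIndex :=
  ⟨by rw [κ.index_layerSubgroup n]; exact pow_ne_zero _ (Fact.out : p.Prime).ne_zero⟩

end ZpExtension

/-! ### Cor. 4.15 along the layers, PROVED -/

/-- **"The same holds for the `p^∞`-Selmer rank (Corollary 4.15)"** (Dokchitser–Dokchitser 2010,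
§4.6, p. 26), PROVED: for an elliptic curve `E` over a number field `K`, an odd prime `p` and any
`ℤ_p`-extension `κ` of `K`, the `p^∞`-Selmer coranks of `E` over `K` and over the layer `K_n` have
the same parity — `Γ_K / Gal(K̄/K_n) ≅ ℤ/p^n` is cyclic of `p`-power order
(`ZpExtension.exists_layerSubgroup_mul_pow`, `index_layerSubgroup`), so the tree theorem
`selmerCorank_mod_two_eq_zpCorank_selmerGroupOver_of_cyclic` (Cor. 4.15 iterated: Lemma 4.14 and
the even dimension of the non-trivial `ℚ_p`-irreducibles of a cyclic `p`-group) applies. Here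
`Sel_{p^∞}(E/K_n)` is the tree's Selmer group over the layer, `E.selmerGroupOver p (κ.layerSubgroup n)`.
[cite: DokchitserDokchitserAnnals2010, Cor. 4.15 and §4.6 (p. 26)] -/
theorem _root_.WeierstrassCurve.selmerCorank_mod_two_eq_zpCorank_selmerGroupOver_layer
    {K : Type} [Field K] [NumberField K] (E : WeierstrassCurve K) [E.IsElliptic]
    (p : ℕ) [Fact p.Prime] (hp : p ≠ 2) (κ : ZpExtension K p) (n : ℕ) :
    E.selmerCorank p % 2 = zpCorank (E.selmerGroupOver p (κ.layerSubgroup n)) p % 2 := by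
  haveI := κ.finiteIndex_layerSubgroup n
  obtain ⟨γ, hγ⟩ := κ.exists_isTopGenerator
  exact E.selmerCorank_mod_two_eq_zpCorank_selmerGroupOver_of_cyclic p
    (κ.layerSubgroup n) hp (κ.isOpen_layerSubgroup n) (κ.exists_layerSubgroup_mul_pow hγ n)
    (κ.index_layerSubgroup n)

/-- Cor. 4.15 along the layers for the base change `E = W_K` of a curve over `ℚ` (the shape used in
§4.6): `rk_p(E/K) ≡ rk_p(E/K_n) (mod 2)`.
[cite: DokchitserDokchitserAnnals2010, Cor. 4.15 and §4.6 (p. 26)] -/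
theorem selmerCorank_baseChange_mod_two_eq_layer (W : WeierstrassCurve ℚ) [W.IsElliptic]
    (p : ℕ) [Fact p.Prime] (hp : p ≠ 2) {K : Type} [Field K] [NumberField K]
    (κ : ZpExtension K p) (n : ℕ) :
    (W.baseChange K).selmerCorank p % 2 =
      zpCorank ((W.baseChange K).selmerGroupOver p (κ.layerSubgroup n)) p % 2 :=
  (W.baseChange K).selmerCorank_mod_two_eq_zpCorank_selmerGroupOver_layer p hp κ n

/-- **`rk_p(E/M_{n+1}) = rk_p(E/M_n) + (p - 1) m_ρ` for some `m_ρ ∈ ℕ`**, PROVED (Dokchitser–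
Dokchitser 2010, proof of Thm. 4.19: "decompose `X = X_p(E/F) ≅ 1^{m_1} ⊕ ε^{m_ε} ⊕ ρ^{m_ρ}`",
with `rk_p(E/M) = m_1 + m_ε` by Lemma 4.14 and `rk_p(E/F) = dim X = m_1 + m_ε + (p-1) m_ρ`, for
`F = M_{n+1}`, `M = M_n`): in the tree's model, `X(n) = corank Sel_{p^∞}(E/M_{n+1})^{Gal(M_{n+1}/M_n)}`
(the relative Lemma 4.14, `zpCorank_selmerGroupOver_eq_relInvariants`), the invariants being those
of the generator `γ^{p^n}` of `Gal(M_{n+1}/M_n) ≅ ℤ/p` (`exists_layerSubgroup_succ_mul_pow`), and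
`corank A = corank A^{⟨c⟩} + (p-1) m` for `c^p = 1` (the tree's
`exists_zpCorank_eq_zpCorank_fixedSub_add`, file `ZpCorankCyclotomicDivisibility`: a
`ℤ_p[ζ_p]`-module has `ℤ_p`-corank divisible by `p - 1`). Here for any elliptic curve `E` over
any number field `K` in place of `E/M₀`, and any `ℤ_p`-extension of `K`. [cite: DokchitserDokchitserAnnals2010, §4.6, proof of Thm. 4.19 (p. 27) with Lemma 4.14] -/
theorem _root_.WeierstrassCurve.exists_zpCorank_selmerGroupOver_layer_succ_eq
    {K : Type} [Field K] [NumberField K] (E : WeierstrassCurve K) [E.IsElliptic]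
    (p : ℕ) [Fact p.Prime] (κ : ZpExtension K p) (n : ℕ) :
    ∃ mρ : ℕ, zpCorank (E.selmerGroupOver p (κ.layerSubgroup (n + 1))) p =
      zpCorank (E.selmerGroupOver p (κ.layerSubgroup n)) p + (p - 1) * mρ := by
  set H := κ.layerSubgroup (n + 1) with hHdef
  set H' := κ.layerSubgroup n with hH'def
  have hle : H ≤ H' := κ.layerSubgroup_antitone n.le_succ
  haveI : (H.subgroupOf H').FiniteIndex := ⟨by
    show H.relIndex H' ≠ 0
    intro h0
    have := Subgroup.relIndex_mul_index hle
    rw [h0, zero_mul, κ.index_layerSubgroup] at this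
    exact pow_ne_zero _ (Fact.out : p.Prime).ne_zero this.symm⟩
  obtain ⟨γ, hγ⟩ := κ.exists_isTopGenerator
  set c := γ ^ p ^ n with hc
  -- relative Lemma 4.14: `X(n) = corank Sel(E/M_{n+1})^{H'}`
  have h414 := E.zpCorank_selmerGroupOver_eq_relInvariants p hle (κ.isOpen_layerSubgroup (n + 1))
    (κ.isOpen_layerSubgroup n)
  -- the conjugation `c_*` on `T = Sel(E/M_{n+1})`
  set T := E.selmerGroupOver p H with hT
  haveI : Finite T[(p : ℤ)] := finite_torsionBy_selmerGroupOver E p H (κ.isOpen_layerSubgroup (n + 1))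
  haveI : CompactSpace (Field.absoluteGaloisGroup K) := compactSpace_absoluteGaloisGroup K
  have hM : ∀ m : geomPrimaryTorsion E p, ∃ k : ℕ, p ^ k • m = 0 := fun m ↦ by
    obtain ⟨k, hk⟩ := AddCommGroup.mem_primaryComponent.mp m.2
    exact ⟨k, Subtype.ext (by rw [AddSubmonoidClass.coe_nsmul, hk, ZeroMemClass.coe_zero])⟩
  have hTprim : ∀ t : T, ∃ m : ℕ, p ^ m • t = 0 := fun t ↦ by
    obtain ⟨m, hm⟩ := exists_pow_nsmul_eq_zero_subgroupH1 H
      (Subgroup.isClosed_of_isOpen H (κ.isOpen_layerSubgroup (n + 1))) hM (t : E.subgroupH1 p H)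
    exact ⟨m, Subtype.ext (by rw [AddSubmonoidClass.coe_nsmul, hm, ZeroMemClass.coe_zero])⟩
  have hstab : ∀ t ∈ T, E.conjH1 p H c t ∈ T := fun t ht ↦
    E.map_conjH1_selmerGroupOver_le_holds p H c ⟨t, ht, rfl⟩
  let cT : AddMonoid.End T := ((E.conjH1 p H c).comp T.subtype).codRestrict T fun t ↦ hstab t t.2
  have hcT : ∀ t : T, ((cT t : T) : E.subgroupH1 p H) = E.conjH1 p H c t := fun _ ↦ rfl
  have hcTpow : ∀ (m : ℕ) (t : T),
      (((cT ^ m) t : T) : E.subgroupH1 p H) = E.conjH1 p H (c ^ m) t := by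
    intro m
    induction m with
    | zero =>
      intro t
      rw [pow_zero, pow_zero, AddMonoid.End.coe_one, id_eq, E.conjH1_one_holds p H,
        AddMonoidHom.id_apply]
    | succ m ih =>
      intro t
      rw [pow_succ, AddMonoid.End.coe_mul, Function.comp_apply, ih, pow_succ,
        E.conjH1_mul_holds p H, AddMonoidHom.comp_apply]
      rfl
  -- `c^p = γ^{p^{n+1}} ∈ H` acts trivially
  have hcpH : c ^ p ∈ H := by
    rw [hc, ← pow_mul, ← pow_succ]
    exact κ.pow_mem_layerSubgroup hγ (n + 1)
  have hcp : cT ^ p = 1 := by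
    refine DFunLike.ext _ _ fun t ↦ ?_
    apply Subtype.ext
    rw [hcTpow, E.conjH1_of_mem_holds p H hcpH, AddMonoidHom.id_apply, AddMonoid.End.coe_one, id_eq]
  -- the invariants of `c_*` in `T` are the `H'`-invariants
  have hKc : ∀ t : T, t ∈ fixedSub cT ↔
      (t : E.subgroupH1 p H) ∈ E.selmerGroupOverRelInvariants p H H' := fun t ↦ by
    rw [mem_fixedSub_iff, mem_selmerGroupOverRelInvariants_iff, Subtype.ext_iff, hcT]
    symm
    refine ⟨fun h ↦ h.2 ⟨c, κ.pow_mem_layerSubgroup hγ n⟩, fun h ↦ ⟨t.2, fun g ↦ ?_⟩⟩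
    obtain ⟨h₁, j, hj⟩ := κ.exists_layerSubgroup_succ_mul_pow hγ n g
    rw [← hc] at hj
    have hk : ∀ j : ℕ, E.conjH1 p H (c ^ j) (t : E.subgroupH1 p H) = t := by
      intro j
      induction j with
      | zero => rw [pow_zero, E.conjH1_one_holds p H, AddMonoidHom.id_apply]
      | succ j ih => rw [pow_succ, E.conjH1_mul_holds p H, AddMonoidHom.comp_apply, h, ih]
    show E.conjH1 p H (g : Field.absoluteGaloisGroup K) (t : E.subgroupH1 p H) = t
    rw [hj, E.conjH1_mul_holds p H, AddMonoidHom.comp_apply, hk, E.conjH1_of_mem_holds p H h₁.2,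
      AddMonoidHom.id_apply]
  have hleT : E.selmerGroupOverRelInvariants p H H' ≤ T := fun y hy ↦
    ((E.mem_selmerGroupOverRelInvariants_iff p y).mp hy).1
  have eK : fixedSub cT ≃+ E.selmerGroupOverRelInvariants p H H' :=
    { toFun := fun t ↦ ⟨((t : T) : E.subgroupH1 p H), (hKc t).mp t.2⟩
      invFun := fun y ↦ ⟨⟨y, hleT y.2⟩, (hKc ⟨y, hleT y.2⟩).mpr y.2⟩
      left_inv := fun _ ↦ rfl
      right_inv := fun _ ↦ rfl
      map_add' := fun _ _ ↦ rfl }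
  obtain ⟨m, hm⟩ := exists_zpCorank_eq_zpCorank_fixedSub_add hcp hTprim
  refine ⟨m, ?_⟩
  rw [hm, zpCorank_congr eK p, ← h414]

/-- `rk_p(E/M_{n+1}) = rk_p(E/M_n) + (p - 1) m_ρ` for the base change `E = W_{M₀}` of a curve over `ℚ`
(the shape used in §4.6). [cite: DokchitserDokchitserAnnals2010, §4.6, proof of Thm. 4.19 (p. 27) with Lemma 4.14] -/
theorem exists_zpCorank_selmerGroupOver_layer_succ_eq (W : WeierstrassCurve ℚ) [W.IsElliptic]
    (p : ℕ) [Fact p.Prime] {K : Type} [Field K] [NumberField K] (κ : ZpExtension K p) (n : ℕ) :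
    ∃ mρ : ℕ, zpCorank ((W.baseChange K).selmerGroupOver p (κ.layerSubgroup (n + 1))) p =
      zpCorank ((W.baseChange K).selmerGroupOver p (κ.layerSubgroup n)) p + (p - 1) * mρ :=
  (W.baseChange K).exists_zpCorank_selmerGroupOver_layer_succ_eq p κ n

/-! ### The assembly, as printed, with Cor. 4.15 and the multiplicity `m_ρ` proved -/

/-- **The skeleton of the printed argument, for any elliptic curve over any number field and any
`ℤ_p`-extension** (Dokchitser–Dokchitser 2010, §4.6, p. 27: "it suffices to show that `m_ρ` is
odd. Now take `n` large enough [...] so `m_ρ = p^n` is odd"; and p. 26: "it suffices to prove the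
parity statement for `E/M_n` for some `n`" by Cor. 4.15). With `X n = corank Sel_{p^∞}(E/K_n)`:
if `X n + m_ρ` is even whenever `X (n+1) = X n + (p-1) m_ρ` (the dihedral congruence) and
`X (n+1) = X n + (p-1) p^n` for all large `n` (the growth), then `rk_p(E/K)` is odd — pick
`n ≥ n₀`, so `m_ρ = p^n` is odd, hence `X n` is odd, hence (Cor. 4.15 along `K ⊂ K_n`, PROVED)
`rk_p(E/K)` is odd. ("Presumably the proof [...] would work for modular abelian varieties over
totally real fields", p. 26: this step is indifferent to the base.)
[cite: DokchitserDokchitserAnnals2010, §4.6, proof of Thm. 4.19 (pp. 26–27)] -/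
theorem _root_.WeierstrassCurve.odd_selmerCorank_of_layer_congruence_of_growth
    {K : Type} [Field K] [NumberField K] (E : WeierstrassCurve K) [E.IsElliptic]
    (p : ℕ) [Fact p.Prime] (hp : p ≠ 2) (κ : ZpExtension K p)
    (hcong : ∀ n mρ : ℕ, zpCorank (E.selmerGroupOver p (κ.layerSubgroup (n + 1))) p =
        zpCorank (E.selmerGroupOver p (κ.layerSubgroup n)) p + (p - 1) * mρ →
      Even (zpCorank (E.selmerGroupOver p (κ.layerSubgroup n)) p + mρ))
    (hgrowth : ∃ n₀ : ℕ, ∀ n ≥ n₀, zpCorank (E.selmerGroupOver p (κ.layerSubgroup (n + 1))) p =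
      zpCorank (E.selmerGroupOver p (κ.layerSubgroup n)) p + (p - 1) * p ^ n) :
    Odd (E.selmerCorank p) := by
  obtain ⟨n₀, hn₀⟩ := hgrowth
  obtain ⟨m, hm⟩ := E.exists_zpCorank_selmerGroupOver_layer_succ_eq p κ (n₀ + 1)
  have heven := hcong (n₀ + 1) m hm
  have hgrow := hn₀ (n₀ + 1) (Nat.le_succ n₀)
  have hp2 : 2 ≤ p := (Fact.out : p.Prime).two_le
  have hmeq : m = p ^ (n₀ + 1) := by
    have h : (p - 1) * m = (p - 1) * p ^ (n₀ + 1) := by omega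
    exact Nat.eq_of_mul_eq_mul_left (by omega) h
  have hpow : Odd (p ^ (n₀ + 1)) := ((Fact.out : p.Prime).odd_of_ne_two hp).pow
  have hlayer : Odd (zpCorank (E.selmerGroupOver p (κ.layerSubgroup (n₀ + 1))) p) := by
    rw [hmeq] at heven
    rcases heven with ⟨a, ha⟩
    rcases hpow with ⟨b, hb⟩
    exact ⟨a - b - 1, by omega⟩
  have htower := E.selmerCorank_mod_two_eq_zpCorank_selmerGroupOver_layer p hp κ (n₀ + 1)
  rw [Nat.odd_iff] at hlayer ⊢
  rw [htower, hlayer]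

/-- **The `p`-parity statement for `E/M₀` from the two printed inputs of p. 27** (Dokchitser–
Dokchitser 2010, §4.6, proof of Thm. 4.19, pp. 26–27): for `E/ℚ` elliptic, `p` odd, `M₀ = K`
imaginary quadratic in which all bad primes of `E` split, and `κ` an anticyclotomic
`ℤ_p`-extension of `M₀`, `rk_p(E/M₀)` is odd. Inputs (with
`X n = zpCorank (Sel_{p^∞}(E/M_n)) p`, the Selmer group over the layer in the tree's model): `h417`
— the dihedral congruence "`rk_p(E/M_n) + m_ρ` even, `(p-1) m_ρ = rk_p(E/M_{n+1}) - rk_p(E/M_n)`";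
`hCV` — "`m_ρ = p^n` for `n` large". Proof, as printed: pick `n ≥ n₀`; `hCV` and `h417` give
`m_ρ = p^n` odd, so `rk_p(E/M_n)` is odd; by Cor. 4.15 along `M₀ ⊂ M_n` (PROVED,
`selmerCorank_baseChange_mod_two_eq_layer`) so is `rk_p(E/M₀)`.
[cite: DokchitserDokchitserAnnals2010, §4.6, proof of Thm. 4.19 (pp. 26–27)] [cite: CornutVatsal2007, Thm. 1.5 and Thm. 4.2] [cite: Nekovar2007, Thm. 3.2] -/
theorem odd_selmerCorank_baseChange_of_anticyclotomic_of_printed'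
    (h417 : ∀ (W : WeierstrassCurve ℚ) [W.IsElliptic] (p : ℕ) [Fact p.Prime], p ≠ 2 →
      ∀ (K : Type) [Field K] [NumberField K], IsImaginaryQuadratic K →
        SatisfiesHeegnerHypothesis (W.conductorNorm ℤ) K →
          ∀ (κ : ZpExtension K p), κ.IsAnticyclotomic → ∀ (n mρ : ℕ),
            zpCorank ((W.baseChange K).selmerGroupOver p (κ.layerSubgroup (n + 1))) p =
                zpCorank ((W.baseChange K).selmerGroupOver p (κ.layerSubgroup n)) p + (p - 1) * mρ →
              Even (zpCorank ((W.baseChange K).selmerGroupOver p (κ.layerSubgroup n)) p + mρ))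
    (hCV : ∀ (W : WeierstrassCurve ℚ) [W.IsElliptic] (p : ℕ) [Fact p.Prime], p ≠ 2 →
      ∀ (K : Type) [Field K] [NumberField K], IsImaginaryQuadratic K →
        SatisfiesHeegnerHypothesis (W.conductorNorm ℤ) K →
          ∀ (κ : ZpExtension K p), κ.IsAnticyclotomic → ∃ n₀ : ℕ, ∀ n ≥ n₀,
            zpCorank ((W.baseChange K).selmerGroupOver p (κ.layerSubgroup (n + 1))) p =
              zpCorank ((W.baseChange K).selmerGroupOver p (κ.layerSubgroup n)) p + (p - 1) * p ^ n)
    (W : WeierstrassCurve ℚ) [W.IsElliptic] (p : ℕ) [Fact p.Prime] (hp : p ≠ 2)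
    (K : Type) [Field K] [NumberField K] (hK : IsImaginaryQuadratic K)
    (hH : SatisfiesHeegnerHypothesis (W.conductorNorm ℤ) K)
    (κ : ZpExtension K p) (hκ : κ.IsAnticyclotomic) :
    Odd ((W.baseChange K).selmerCorank p) :=
  (W.baseChange K).odd_selmerCorank_of_layer_congruence_of_growth p hp κ
    (h417 W p hp K hK hH κ hκ) (hCV W p hp K hK hH κ hκ)

/-- **Step (4) of the proof of Thm. 4.19 (= Thm. 1.4) from `hanti`, `h417`, `hCV` — Cor. 4.15
proved**: the target fact `dokchitser_selmerCorank_baseChange_mod_two_eq` (`rk_p(E/M₀)` is odd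
for `E/ℚ` elliptic, `p` odd, `M₀` imaginary quadratic with all bad primes split) from the
existence of the anticyclotomic `ℤ_p`-extension of `M₀` (`hanti`, tree fact
`ZpExtension.exists_isAnticyclotomic`), the dihedral congruence (`h417`, Lemma 4.14 + Prop. 4.17)
and Cornut–Vatsal / Tian–Zhang / Nekovář (`hCV`), through
`odd_selmerCorank_baseChange_of_anticyclotomic_of_printed'`. Compared with
`dokchitser_selmerCorank_baseChange_mod_two_eq_of_printed` (file
`BSDSelmerParityDokchitserHeegnerFieldProofs`) the hypothesis `h415` (Cor. 4.15) is gone: it is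
now a theorem of the tree. [cite: DokchitserDokchitserAnnals2010, §4.6, proof of Thm. 4.19 (= Thm. 1.4), pp. 26–27] -/
theorem dokchitser_selmerCorank_baseChange_mod_two_eq_of_printed'
    (hanti : ∀ (K : Type) [Field K] [NumberField K] (p : ℕ) [Fact p.Prime],
      ZpExtension.exists_isAnticyclotomic (K := K) (p := p))
    (h417 : ∀ (W : WeierstrassCurve ℚ) [W.IsElliptic] (p : ℕ) [Fact p.Prime], p ≠ 2 →
      ∀ (K : Type) [Field K] [NumberField K], IsImaginaryQuadratic K →
        SatisfiesHeegnerHypothesis (W.conductorNorm ℤ) K →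
          ∀ (κ : ZpExtension K p), κ.IsAnticyclotomic → ∀ (n mρ : ℕ),
            zpCorank ((W.baseChange K).selmerGroupOver p (κ.layerSubgroup (n + 1))) p =
                zpCorank ((W.baseChange K).selmerGroupOver p (κ.layerSubgroup n)) p + (p - 1) * mρ →
              Even (zpCorank ((W.baseChange K).selmerGroupOver p (κ.layerSubgroup n)) p + mρ))
    (hCV : ∀ (W : WeierstrassCurve ℚ) [W.IsElliptic] (p : ℕ) [Fact p.Prime], p ≠ 2 →
      ∀ (K : Type) [Field K] [NumberField K], IsImaginaryQuadratic K →
        SatisfiesHeegnerHypothesis (W.conductorNorm ℤ) K →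
          ∀ (κ : ZpExtension K p), κ.IsAnticyclotomic → ∃ n₀ : ℕ, ∀ n ≥ n₀,
            zpCorank ((W.baseChange K).selmerGroupOver p (κ.layerSubgroup (n + 1))) p =
              zpCorank ((W.baseChange K).selmerGroupOver p (κ.layerSubgroup n)) p + (p - 1) * p ^ n) :
    dokchitser_selmerCorank_baseChange_mod_two_eq := by
  intro W _ p _ hp K _ _ hK hH
  haveI : NumberField.IsTotallyComplex K := hK.2
  obtain ⟨κ, hκ⟩ := hanti K p hK.1 NumberField.IsTotallyComplex.isComplex
  exact Nat.odd_iff.mp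
    (odd_selmerCorank_baseChange_of_anticyclotomic_of_printed' h417 hCV W p hp K hK hH κ hκ)

/-- **Step (4) of the proof of Thm. 4.19 (= Thm. 1.4) from its two printed external inputs only —
`hanti` and Cor. 4.15 discharged.** The existence of the anticyclotomic `ℤ_p`-extension of the
imaginary quadratic field `M₀` ("Let `M_n` denote the `n`-th layer in the anticyclotomic
`ℤ_p`-extension of `M₀`", p. 26) is the tree theorem `ZpExtension.exists_isAnticyclotomic_holds`
(`ZpExtensionAnticyclotomicHoldsProofs`: Washington Thm. 13.4 from global class field theory), and
Cor. 4.15 along the tower and the multiplicity `m_ρ` are proved above; what remains of the printed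
proof for `E/M₀` is exactly (i) the dihedral congruence `rk_p(E/M_n) + m_ρ ≡ 0 (mod 2)` (`h417`:
Prop. 4.17 for `Gal(M_{n+1}/K_n) ≅ D_{2p}` with `C(E/M_{n+1})`, `C(E/M_n)` squares, all bad primes
being split in `M₀`) and (ii) `m_ρ = p^n` for `n` large (`hCV`: Cornut–Vatsal Thm. 1.5 / 4.2 with
Tian–Zhang / Nekovář Thm. 3.2).
[cite: DokchitserDokchitserAnnals2010, §4.6, proof of Thm. 4.19 (= Thm. 1.4), pp. 26–27] -/
theorem dokchitser_selmerCorank_baseChange_mod_two_eq_of_printed''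
    (h417 : ∀ (W : WeierstrassCurve ℚ) [W.IsElliptic] (p : ℕ) [Fact p.Prime], p ≠ 2 →
      ∀ (K : Type) [Field K] [NumberField K], IsImaginaryQuadratic K →
        SatisfiesHeegnerHypothesis (W.conductorNorm ℤ) K →
          ∀ (κ : ZpExtension K p), κ.IsAnticyclotomic → ∀ (n mρ : ℕ),
            zpCorank ((W.baseChange K).selmerGroupOver p (κ.layerSubgroup (n + 1))) p =
                zpCorank ((W.baseChange K).selmerGroupOver p (κ.layerSubgroup n)) p + (p - 1) * mρ →
              Even (zpCorank ((W.baseChange K).selmerGroupOver p (κ.layerSubgroup n)) p + mρ))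
    (hCV : ∀ (W : WeierstrassCurve ℚ) [W.IsElliptic] (p : ℕ) [Fact p.Prime], p ≠ 2 →
      ∀ (K : Type) [Field K] [NumberField K], IsImaginaryQuadratic K →
        SatisfiesHeegnerHypothesis (W.conductorNorm ℤ) K →
          ∀ (κ : ZpExtension K p), κ.IsAnticyclotomic → ∃ n₀ : ℕ, ∀ n ≥ n₀,
            zpCorank ((W.baseChange K).selmerGroupOver p (κ.layerSubgroup (n + 1))) p =
              zpCorank ((W.baseChange K).selmerGroupOver p (κ.layerSubgroup n)) p + (p - 1) * p ^ n) :
    dokchitser_selmerCorank_baseChange_mod_two_eq :=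
  dokchitser_selmerCorank_baseChange_mod_two_eq_of_printed'
    (fun K _ _ p _ => @ZpExtension.exists_isAnticyclotomic_holds K _ p _) h417 hCV

end Literature.NumberTheory.EllipticCurves
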